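import Summits.RiemannHypothesis.RiemannHypothesis.Theorems.WeilGroundStateGroundStatesConvergeToXiStubPhiTranslateHarmonic
import Summits.RiemannHypothesis.RiemannHypothesis.Theorems.WeilGroundStateGroundStatesConvergeToXiStubPrimeTermTruncation
import Summits.RiemannHypothesis.RiemannHypothesis.Theorems.WeilGroundStateGroundStatesConvergeToXiEnergyUpperTail
import Summits.RiemannHypothesis.RiemannHypothesis.Theorems.WeilGroundStateGroundStatesConvergeToXiPhiTail
import Summits.RiemannHypothesis.RiemannHypothesis.Theorems.WeilGroundStateGroundStatesConvergeToXiStubMellinXi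
import Literature.NumberTheory.LFunctions.WeilExplicit
import Literature.NumberTheory.LFunctions.WeilMarkovQuadratic
import HarnessLib

/-!
# `WeilGroundState.GroundStatesConvergeToXi` — the prime term of `(Φw) ⋆ (Φw)~` through jump energies
(crux item stmt-RiemannHypothesis-1527, route route-RiemannHypothesis-WeilGroundState; line `Sketch`,
stub `stub_doob_prime` (D1); `--supports`)

Dictionary (inline, no definitions): `Φ(t) = 2Ψ(2t)` is Riemann's kernel (real form
`2 * LagariasMontague.Psi (2 * t)`, complex form `(2 : ℂ) * LagariasMontague.Psic (2 * t)`); for a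
test function `w`, `u = Φ·w`, `k = u ⋆ ũ = weilConv u (weilReflect u)`, `g_w(x) = Φ(x) ‖w x‖²`, the
`Φ`-weighted jump energy `I_w(h) = ∫ Φ(t) Φ(t+h) ‖w(t+h) − w(t)‖² dt` and the translate
`τ_xΦ = Φ(· + x)`.

* POLARISATION (`doobP_polar`, `doobP_increment`): for real `A = Φ(x+h)`, `B = Φ(x)` and complex
  `p = w(x+h)`, `q = w(x)`, `‖Ap − Bq‖² = AB‖p − q‖² + (A − B)(A‖p‖² − B‖q‖²)`; integrating in `x`
  and substituting `y = x + h` in the `A‖p‖²` piece,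
  `2‖u‖₂² − ∫‖u(x+h) − u(x)‖² dx = ∫ g_w(x) (Φ(h+x) + Φ(−h+x)) dx − I_w(h)` for EVERY `h`, whence
  `k(h) + k(−h) = ⟨g_w, Φ(h+·) + Φ(−h+·)⟩ − I_w(h)` (`weilConv_weilReflect_add_neg`).
* SUMMATION (`doobP_main`): with the weights `Λ(n) n^{-1/2}` at `h = log n`,
  `Σ'_n Λ(n) n^{-1/2} ⟨g_w, Φ(log n + ·) + Φ(−log n + ·)⟩ = ∫ g_w(x) · weilPrimeTerm (τ_xΦ) dx`
  (`integral_tsum_of_summable_integral_norm` with the majorant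
  `|Φ(t + x)| ≤ K e^{|x|} e^{−|t|}` on the support `|x| ≤ A` of `w` and `Σ Λ(n) n^{-3/2} < ∞`,
  `ptTrunc_summable_majorant`); `x ↦ weilPrimeTerm (τ_xΦ)` is continuous (locally uniform
  convergence), so `g_w · weilPrimeTerm (τ_·Φ)` is integrable; the `I_w`-series converges since
  the `k`-series has finite support (`summable_weilPrimeTerm`).  All of this is done for a general
  continuous real `φ` with `|φ(t + x)| ≤ K e^{|x|} e^{−|t|}`, then specialised to `Φ`
  (`doobP_exists_bound`, from the double-exponential envelope of `…PhiTail`).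

No new definitions; no named fact is used.
-/

noncomputable section

set_option linter.dupNamespace false

open scoped Topology Real ComplexConjugate ArithmeticFunction.vonMangoldt
open Filter Set MeasureTheory Complex

namespace Summit.RiemannHypothesis.RiemannHypothesis.Theorems.GroundStatesConvergeToXi

open Literature.NumberTheory.LFunctions

/-! ## Pointwise algebra and integrability helpers -/

/-- Polarisation: for real `a, b` and complex `p, q`,
`‖a p − b q‖² = b a ‖p − q‖² + ((a − b) a ‖p‖² − (a − b) b ‖q‖²)`. [folklore] -/
theorem doobP_polar (a b : ℝ) (p q : ℂ) :
    ‖(a : ℂ) * p - (b : ℂ) * q‖ ^ 2 =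
      b * a * ‖p - q‖ ^ 2 + ((a - b) * (a * ‖p‖ ^ 2) - (a - b) * (b * ‖q‖ ^ 2)) := by
  simp only [Complex.sq_norm, Complex.normSq_apply, Complex.sub_re, Complex.sub_im,
    Complex.mul_re, Complex.mul_im, Complex.ofReal_re, Complex.ofReal_im, zero_mul, sub_zero]
  ring

/-- A bounded continuous real multiplier preserves integrability (left). [folklore] -/
theorem doobP_integrable_mul {m f : ℝ → ℝ} (hm : Continuous m) {C : ℝ} (hC : ∀ x, |m x| ≤ C)
    (hf : Integrable f) : Integrable fun x => m x * f x :=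
  hf.bdd_mul hm.aestronglyMeasurable (ae_of_all _ fun x => by rw [Real.norm_eq_abs]; exact hC x)

/-- A bounded continuous real multiplier preserves integrability (right). [folklore] -/
theorem doobP_integrable_mul' {f m : ℝ → ℝ} (hf : Integrable f) (hm : Continuous m) {C : ℝ}
    (hC : ∀ x, |m x| ≤ C) : Integrable fun x => f x * m x :=
  hf.mul_bdd hm.aestronglyMeasurable (ae_of_all _ fun x => by rw [Real.norm_eq_abs]; exact hC x)

/-! ## The increment of `u = φ·w`, polarised -/

/-- **Polarised increment.** For a continuous bounded real `φ`, a test function `w` and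
`u = φ·w`: `2‖u‖₂² − ∫ ‖u(x+h) − u(x)‖² dx = ∫ φ(x)‖w x‖² (φ(h+x) + φ(−h+x)) dx − I(h)` with
`I(h) = ∫ φ(x) φ(x+h) ‖w(x+h) − w(x)‖² dx` (pointwise polarisation, then the substitution
`y = x + h` in the `φ(x+h)²‖w(x+h)‖²`-type piece). [folklore] -/
theorem doobP_increment {φ : ℝ → ℝ} (hφc : Continuous φ) {K : ℝ} (hK : ∀ t, |φ t| ≤ K)
    {w u : ℝ → ℂ} (hw : IsWeilTest w) (hu : ∀ t, u t = (φ t : ℂ) * w t) (h : ℝ) :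
    2 * (∫ x : ℝ, ‖u x‖ ^ 2) - weilIncrement u h =
      (∫ x : ℝ, φ x * ‖w x‖ ^ 2 * (φ (h + x) + φ (-h + x))) -
        ∫ x : ℝ, φ x * φ (x + h) * ‖w (x + h) - w x‖ ^ 2 := by
  have hK0 : 0 ≤ K := (abs_nonneg _).trans (hK 0)
  have h2K : ∀ a b : ℝ, |φ a - φ b| ≤ K + K := fun a b =>
    (abs_sub _ _).trans (add_le_add (hK _) (hK _))
  have hwc : Continuous w := hw.1.continuous
  have hw2 : Integrable fun x : ℝ => ‖w x‖ ^ 2 := hw.integrable_norm_sq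
  have hg : Integrable fun x : ℝ => φ x * ‖w x‖ ^ 2 := doobP_integrable_mul hφc hK hw2
  have hgh : Integrable fun x : ℝ => φ (x + h) * ‖w (x + h)‖ ^ 2 := hg.comp_add_right h
  have hD : Integrable fun x : ℝ => ‖w (x + h) - w x‖ ^ 2 :=
    integrable_weilIncrement_integrand hw.memLp_two h
  -- the integrands
  have ha : Integrable fun x : ℝ => φ x * φ (x + h) * ‖w (x + h) - w x‖ ^ 2 :=
    doobP_integrable_mul (by fun_prop) (C := K * K)
      (fun x => by rw [abs_mul]; exact mul_le_mul (hK _) (hK _) (abs_nonneg _) hK0) hD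
  have hb : Integrable fun x : ℝ => (φ (x + h) - φ x) * (φ (x + h) * ‖w (x + h)‖ ^ 2) :=
    doobP_integrable_mul (by fun_prop) (fun x => h2K _ _) hgh
  have hb' : Integrable fun x : ℝ => (φ x - φ (x - h)) * (φ x * ‖w x‖ ^ 2) :=
    doobP_integrable_mul (by fun_prop) (fun x => h2K _ _) hg
  have hc : Integrable fun x : ℝ => (φ (x + h) - φ x) * (φ x * ‖w x‖ ^ 2) :=
    doobP_integrable_mul (by fun_prop) (fun x => h2K _ _) hg
  have hG : Integrable fun x : ℝ => φ x * (φ x * ‖w x‖ ^ 2) := doobP_integrable_mul hφc hK hg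
  have hJ : Integrable fun x : ℝ => φ x * ‖w x‖ ^ 2 * (φ (h + x) + φ (-h + x)) :=
    doobP_integrable_mul' hg (by fun_prop)
      (fun x => (abs_add_le _ _).trans (add_le_add (hK _) (hK _)))
  -- (iv) `‖u‖₂²`
  have hN : (∫ x : ℝ, ‖u x‖ ^ 2) = ∫ x : ℝ, φ x * (φ x * ‖w x‖ ^ 2) := by
    refine integral_congr_ae (ae_of_all _ fun x => ?_)
    beta_reduce
    rw [hu, norm_mul, Complex.norm_real, Real.norm_eq_abs, mul_pow, sq_abs]
    ring
  -- (i) polarisation under the integral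
  have hI : weilIncrement u h = (∫ x : ℝ, φ x * φ (x + h) * ‖w (x + h) - w x‖ ^ 2) +
      ((∫ x : ℝ, (φ (x + h) - φ x) * (φ (x + h) * ‖w (x + h)‖ ^ 2)) -
        ∫ x : ℝ, (φ (x + h) - φ x) * (φ x * ‖w x‖ ^ 2)) := by
    rw [← integral_sub hb hc, ← integral_add ha (hb.sub' hc)]
    simp only [weilIncrement]
    refine integral_congr_ae (ae_of_all _ fun x => ?_)
    beta_reduce
    rw [hu, hu, doobP_polar]
  -- (ii) the substitution `y = x + h`
  have hshift : (∫ x : ℝ, (φ (x + h) - φ x) * (φ (x + h) * ‖w (x + h)‖ ^ 2)) =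
      ∫ x : ℝ, (φ x - φ (x - h)) * (φ x * ‖w x‖ ^ 2) := by
    have e := integral_add_right_eq_self (μ := volume)
      (fun x : ℝ => (φ x - φ (x - h)) * (φ x * ‖w x‖ ^ 2)) h
    simp only [add_sub_cancel_right] at e
    exact e
  -- (iii) recombination
  have hiii : (∫ x : ℝ, (φ x - φ (x - h)) * (φ x * ‖w x‖ ^ 2)) -
      (∫ x : ℝ, (φ (x + h) - φ x) * (φ x * ‖w x‖ ^ 2)) =
      2 * (∫ x : ℝ, φ x * (φ x * ‖w x‖ ^ 2)) -
        ∫ x : ℝ, φ x * ‖w x‖ ^ 2 * (φ (h + x) + φ (-h + x)) := by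
    rw [← integral_sub hb' hc, ← integral_const_mul, ← integral_sub (hG.const_mul 2) hJ]
    refine integral_congr_ae (ae_of_all _ fun x => ?_)
    beta_reduce
    rw [neg_add_eq_sub, add_comm h x]
    ring
  rw [hN, hI, hshift]
  linarith [hiii]

/-! ## The prime-weighted sums -/

/-- `Σ_n Λ(n) n^{-1/2} (e^{-|log n|} + e^{-|-log n|}) < ∞` (i.e. `2 Σ Λ(n) n^{-3/2} < ∞`;
`ptTrunc_summable_majorant` at rate `1`). [folklore] -/
theorem doobP_summable_majorant :
    Summable fun n : ℕ => (Λ n : ℝ) / Real.sqrt n *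
      (Real.exp (-|Real.log n|) + Real.exp (-|-Real.log n|)) := by
  have h := ptTrunc_summable_majorant (f := fun t : ℝ => ((Real.exp (-|t|) : ℝ) : ℂ)) (C := 1)
    (b₀ := 1) (by norm_num) (fun t => le_of_eq (by
      rw [Complex.norm_real, Real.norm_of_nonneg (Real.exp_pos _).le, one_mul, one_mul]))
  refine h.congr fun n => ?_
  rw [norm_div, Complex.norm_of_nonneg ArithmeticFunction.vonMangoldt_nonneg,
    Complex.norm_of_nonneg (Real.sqrt_nonneg _), Complex.norm_of_nonneg (Real.exp_pos _).le,
    Complex.norm_of_nonneg (Real.exp_pos _).le]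

/-- Termwise bound: if `|φ(t + x)| ≤ K e^{|x|} e^{-|t|}` and `|x| ≤ B`, then
`|Λ(n) n^{-1/2} (φ(log n + x) + φ(-log n + x))| ≤ K e^{B} Λ(n) n^{-1/2} (e^{-|log n|} + e^{-|-log n|})`.
[folklore] -/
theorem doobP_term_bound {φ : ℝ → ℝ} {K : ℝ} (hK0 : 0 ≤ K)
    (hφb : ∀ t x : ℝ, |φ (t + x)| ≤ K * Real.exp |x| * Real.exp (-|t|))
    {B x : ℝ} (hx : |x| ≤ B) (n : ℕ) :
    |(Λ n : ℝ) / Real.sqrt n * (φ (Real.log n + x) + φ (-Real.log n + x))| ≤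
      K * Real.exp B * ((Λ n : ℝ) / Real.sqrt n *
        (Real.exp (-|Real.log n|) + Real.exp (-|-Real.log n|))) := by
  have hΛ : 0 ≤ (Λ n : ℝ) / Real.sqrt n :=
    div_nonneg ArithmeticFunction.vonMangoldt_nonneg (Real.sqrt_nonneg _)
  rw [abs_mul, abs_of_nonneg hΛ]
  have hB : Real.exp |x| ≤ Real.exp B := Real.exp_le_exp.2 hx
  have h1 : ∀ t : ℝ, |φ (t + x)| ≤ K * Real.exp B * Real.exp (-|t|) := fun t =>
    (hφb t x).trans (mul_le_mul_of_nonneg_right (mul_le_mul_of_nonneg_left hB hK0)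
      (Real.exp_pos _).le)
  calc (Λ n : ℝ) / Real.sqrt n * |φ (Real.log n + x) + φ (-Real.log n + x)|
      ≤ (Λ n : ℝ) / Real.sqrt n * (K * Real.exp B * Real.exp (-|Real.log n|) +
          K * Real.exp B * Real.exp (-|-Real.log n|)) :=
        mul_le_mul_of_nonneg_left ((abs_add_le _ _).trans (add_le_add (h1 _) (h1 _))) hΛ
    _ = _ := by ring

/-- **Continuity of `x ↦ Σ'_n Λ(n) n^{-1/2} (φ(log n + x) + φ(-log n + x))`** (the prime term of
the translate `φ(· + x)`): the series converges uniformly on every `[-B, B]`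
(`continuousOn_tsum` with the majorant of `doobP_term_bound`). [folklore] -/
theorem doobP_continuous_primeSum {φ : ℝ → ℝ} (hφc : Continuous φ) {K : ℝ} (hK0 : 0 ≤ K)
    (hφb : ∀ t x : ℝ, |φ (t + x)| ≤ K * Real.exp |x| * Real.exp (-|t|)) :
    Continuous fun x : ℝ => ∑' n : ℕ, (Λ n : ℝ) / Real.sqrt n *
      (φ (Real.log n + x) + φ (-Real.log n + x)) := by
  refine continuous_iff_continuousAt.2 fun x₀ => ?_
  have hon : ContinuousOn (fun x : ℝ => ∑' n : ℕ, (Λ n : ℝ) / Real.sqrt n *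
      (φ (Real.log n + x) + φ (-Real.log n + x))) (Icc (-(|x₀| + 1)) (|x₀| + 1)) := by
    refine continuousOn_tsum (fun n => Continuous.continuousOn (by fun_prop))
      (doobP_summable_majorant.mul_left (K * Real.exp (|x₀| + 1))) (fun n x hx => ?_)
    rw [Real.norm_eq_abs]
    exact doobP_term_bound hK0 hφb (abs_le.2 ⟨hx.1, hx.2⟩) n
  exact hon.continuousAt (Icc_mem_nhds (by linarith [neg_abs_le x₀]) (by linarith [le_abs_self x₀]))

/-! ## The prime term of `k = u ⋆ ũ`, `u = φ·w` -/

/-- **The Doob prime identity for a general weight.**  For a continuous real `φ` with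
`|φ(t + x)| ≤ K e^{|x|} e^{-|t|}`, a test function `w` and a test function `u = φ·w`, with
`I(h) = ∫ φ(t)φ(t+h)‖w(t+h) − w(t)‖² dt` and `g(x) = φ(x)‖w x‖²`:
`Σ_n Λ(n) n^{-1/2} I(log n) < ∞`, `g · weilPrimeTerm (φ(· + x))` is integrable, and
`weilPrimeTerm (u ⋆ ũ) = ∫ g(x) weilPrimeTerm (φ(· + x)) dx − Σ'_n Λ(n) n^{-1/2} I(log n)`
(`k(h) + k(−h) = ⟨g, φ(h+·) + φ(−h+·)⟩ − I(h)` by `doobP_increment`, then `∫`/`Σ'` swap by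
`integral_tsum_of_summable_integral_norm`). [folklore] -/
theorem doobP_main {φ : ℝ → ℝ} (hφc : Continuous φ) {K : ℝ} (hK0 : 0 ≤ K)
    (hφb : ∀ t x : ℝ, |φ (t + x)| ≤ K * Real.exp |x| * Real.exp (-|t|))
    {w u : ℝ → ℂ} (hw : IsWeilTest w) (huT : IsWeilTest u) (hu : ∀ t, u t = (φ t : ℂ) * w t) :
    Summable (fun n : ℕ => (Λ n : ℝ) / Real.sqrt n *
        ∫ t : ℝ, φ t * φ (t + Real.log n) * ‖w (t + Real.log n) - w t‖ ^ 2) ∧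
    Integrable (fun x : ℝ => ((φ x * ‖w x‖ ^ 2 : ℝ) : ℂ) *
        weilPrimeTerm (fun t : ℝ => (φ (t + x) : ℂ))) ∧
    weilPrimeTerm (weilConv u (weilReflect u)) =
      (∫ x : ℝ, ((φ x * ‖w x‖ ^ 2 : ℝ) : ℂ) * weilPrimeTerm (fun t : ℝ => (φ (t + x) : ℂ))) -
        ((∑' n : ℕ, (Λ n : ℝ) / Real.sqrt n *
          ∫ t : ℝ, φ t * φ (t + Real.log n) * ‖w (t + Real.log n) - w t‖ ^ 2 : ℝ) : ℂ) := by
  -- the global bound and the support of `w`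
  have hK : ∀ t, |φ t| ≤ K := fun t => by
    have h := hφb t 0
    rw [add_zero, abs_zero, Real.exp_zero, mul_one] at h
    exact h.trans (mul_le_of_le_one_right hK0
      (Real.exp_le_one_iff.mpr (neg_nonpos.mpr (abs_nonneg t))))
  have hwc : Continuous w := hw.1.continuous
  obtain ⟨A, hA⟩ := hw.2.isCompact.isBounded.subset_closedBall 0
  have hwA : ∀ x, w x ≠ 0 → |x| ≤ A := fun x hx => by
    have h := hA (subset_tsupport _ hx)
    rwa [Metric.mem_closedBall, dist_zero_right, Real.norm_eq_abs] at h
  have hΛ : ∀ n : ℕ, 0 ≤ (Λ n : ℝ) / Real.sqrt n := fun n =>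
    div_nonneg ArithmeticFunction.vonMangoldt_nonneg (Real.sqrt_nonneg _)
  -- `g = φ ‖w‖²`
  have hgc : Continuous fun x : ℝ => φ x * ‖w x‖ ^ 2 := by fun_prop
  have hgi : Integrable fun x : ℝ => φ x * ‖w x‖ ^ 2 :=
    doobP_integrable_mul hφc hK hw.integrable_norm_sq
  -- the terms `F n x = g(x) Λ(n) n^{-1/2} (φ(log n + x) + φ(-log n + x))`
  have hM := doobP_summable_majorant
  have hFi : ∀ n : ℕ, Integrable fun x : ℝ => φ x * ‖w x‖ ^ 2 *
      ((Λ n : ℝ) / Real.sqrt n * (φ (Real.log n + x) + φ (-Real.log n + x))) := fun n =>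
    doobP_integrable_mul' hgi (by fun_prop) (C := (Λ n : ℝ) / Real.sqrt n * (K + K)) fun x => by
      rw [abs_mul, abs_of_nonneg (hΛ n)]
      exact mul_le_mul_of_nonneg_left ((abs_add_le _ _).trans (add_le_add (hK _) (hK _))) (hΛ n)
  have hFb : ∀ (n : ℕ) (x : ℝ), ‖φ x * ‖w x‖ ^ 2 *
      ((Λ n : ℝ) / Real.sqrt n * (φ (Real.log n + x) + φ (-Real.log n + x)))‖ ≤
      ‖φ x * ‖w x‖ ^ 2‖ * (K * Real.exp A * ((Λ n : ℝ) / Real.sqrt n *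
        (Real.exp (-|Real.log n|) + Real.exp (-|-Real.log n|)))) := by
    intro n x
    by_cases hx : w x = 0
    · simp [hx]
    rw [norm_mul]
    exact mul_le_mul_of_nonneg_left
      (by rw [Real.norm_eq_abs]; exact doobP_term_bound hK0 hφb (hwA x hx) n) (norm_nonneg _)
  have hFs : Summable fun n : ℕ => ∫ x : ℝ, ‖φ x * ‖w x‖ ^ 2 *
      ((Λ n : ℝ) / Real.sqrt n * (φ (Real.log n + x) + φ (-Real.log n + x)))‖ :=
    ((hM.mul_left (K * Real.exp A)).mul_left (∫ x : ℝ, ‖φ x * ‖w x‖ ^ 2‖)).of_nonneg_of_le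
      (fun n => integral_nonneg fun x => norm_nonneg _) (fun n =>
        (integral_mono (hFi n).norm (hgi.norm.mul_const _) (hFb n)).trans_eq
          (integral_mul_const _ _))
  -- the prime term of the translate `φ(· + x)` as a real series `P x`
  have hPc := doobP_continuous_primeSum hφc hK0 hφb
  have hP : ∀ x : ℝ, weilPrimeTerm (fun t : ℝ => (φ (t + x) : ℂ)) =
      ((∑' n : ℕ, (Λ n : ℝ) / Real.sqrt n * (φ (Real.log n + x) + φ (-Real.log n + x)) : ℝ) : ℂ) := by
    intro x
    rw [Complex.ofReal_tsum]
    simp only [weilPrimeTerm]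
    push_cast
    rfl
  -- `Σ' ∫ = ∫ Σ'`
  have hswap := integral_tsum_of_summable_integral_norm hFi hFs
  have hsumF : ∀ x : ℝ, ∑' n : ℕ, φ x * ‖w x‖ ^ 2 *
      ((Λ n : ℝ) / Real.sqrt n * (φ (Real.log n + x) + φ (-Real.log n + x))) =
      φ x * ‖w x‖ ^ 2 * ∑' n : ℕ, (Λ n : ℝ) / Real.sqrt n *
        (φ (Real.log n + x) + φ (-Real.log n + x)) := fun x => tsum_mul_left
  have hintF : ∀ n : ℕ, (∫ x : ℝ, φ x * ‖w x‖ ^ 2 *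
      ((Λ n : ℝ) / Real.sqrt n * (φ (Real.log n + x) + φ (-Real.log n + x)))) =
      (Λ n : ℝ) / Real.sqrt n *
        ∫ x : ℝ, φ x * ‖w x‖ ^ 2 * (φ (Real.log n + x) + φ (-Real.log n + x)) := fun n => by
    rw [← integral_const_mul]
    refine integral_congr_ae (ae_of_all _ fun x => ?_)
    beta_reduce
    ring
  simp_rw [hsumF, hintF] at hswap
  have hJs : Summable fun n : ℕ => (Λ n : ℝ) / Real.sqrt n *
      ∫ x : ℝ, φ x * ‖w x‖ ^ 2 * (φ (Real.log n + x) + φ (-Real.log n + x)) := by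
    refine hFs.of_norm_bounded fun n => ?_
    rw [← hintF n]
    exact norm_integral_le_integral_norm _
  -- the `k`-series through `doobP_increment`
  have hkT : IsWeilTest (weilConv u (weilReflect u)) := huT.weilConv huT.weilReflect
  have hterm : ∀ n : ℕ, ((Λ n : ℝ) : ℂ) / (Real.sqrt n : ℂ) *
      (weilConv u (weilReflect u) (Real.log n) + weilConv u (weilReflect u) (-Real.log n)) =
      (((Λ n : ℝ) / Real.sqrt n *
          (∫ x : ℝ, φ x * ‖w x‖ ^ 2 * (φ (Real.log n + x) + φ (-Real.log n + x))) -
        (Λ n : ℝ) / Real.sqrt n *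
          ∫ t : ℝ, φ t * φ (t + Real.log n) * ‖w (t + Real.log n) - w t‖ ^ 2 : ℝ) : ℂ) := by
    intro n
    rw [weilConv_weilReflect_add_neg huT, doobP_increment hφc hK hw hu]
    push_cast
    ring
  have hDs : Summable fun n : ℕ => ((Λ n : ℝ) / Real.sqrt n *
        (∫ x : ℝ, φ x * ‖w x‖ ^ 2 * (φ (Real.log n + x) + φ (-Real.log n + x))) -
      (Λ n : ℝ) / Real.sqrt n *
        ∫ t : ℝ, φ t * φ (t + Real.log n) * ‖w (t + Real.log n) - w t‖ ^ 2) :=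
    Complex.summable_ofReal.1 ((summable_weilPrimeTerm hkT.2).congr hterm)
  have hIs : Summable fun n : ℕ => (Λ n : ℝ) / Real.sqrt n *
      ∫ t : ℝ, φ t * φ (t + Real.log n) * ‖w (t + Real.log n) - w t‖ ^ 2 := by
    refine (hJs.sub hDs).congr fun n => ?_
    ring
  refine ⟨hIs, ?_, ?_⟩
  · -- integrability of `g · weilPrimeTerm (φ(· + x))`
    have hfun : (fun x : ℝ => ((φ x * ‖w x‖ ^ 2 : ℝ) : ℂ) *
        weilPrimeTerm (fun t : ℝ => (φ (t + x) : ℂ))) = fun x : ℝ =>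
        ((φ x * ‖w x‖ ^ 2 * ∑' n : ℕ, (Λ n : ℝ) / Real.sqrt n *
          (φ (Real.log n + x) + φ (-Real.log n + x)) : ℝ) : ℂ) := by
      funext x
      rw [hP, ← Complex.ofReal_mul]
    rw [hfun]
    refine Integrable.ofReal ((hgc.mul hPc).integrable_of_hasCompactSupport ?_)
    refine HasCompactSupport.intro (isCompact_closedBall (0 : ℝ) A) fun x hx => ?_
    have hw0 : w x = 0 := by
      by_contra hne
      exact hx (Metric.mem_closedBall.2
        (by rw [dist_zero_right, Real.norm_eq_abs]; exact hwA x hne))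
    simp [hw0]
  · -- the identity
    have lhs : weilPrimeTerm (weilConv u (weilReflect u)) =
        ((∑' n : ℕ, ((Λ n : ℝ) / Real.sqrt n *
            (∫ x : ℝ, φ x * ‖w x‖ ^ 2 * (φ (Real.log n + x) + φ (-Real.log n + x))) -
          (Λ n : ℝ) / Real.sqrt n *
            ∫ t : ℝ, φ t * φ (t + Real.log n) * ‖w (t + Real.log n) - w t‖ ^ 2) : ℝ) : ℂ) := by
      rw [Complex.ofReal_tsum]
      exact tsum_congr hterm
    rw [lhs, Summable.tsum_sub hJs hIs, Complex.ofReal_sub, hswap, ← integral_complex_ofReal]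
    congr 1
    refine integral_congr_ae (ae_of_all _ fun x => ?_)
    beta_reduce
    rw [hP, Complex.ofReal_mul]

/-! ## Specialisation to Riemann's kernel `Φ(t) = 2Ψ(2t)` -/

/-- `Φ` in complex form is the cast of its real form: `2 Psic(2s) = ((2 Ψ(2s) : ℝ) : ℂ)`. [folklore] -/
theorem doobP_phic (s : ℝ) :
    (2 : ℂ) * LagariasMontague.Psic (2 * s) = ((2 * LagariasMontague.Psi (2 * s) : ℝ) : ℂ) := by
  rw [LagariasMontague.Psic]
  push_cast
  ring

/-- **Translated rate-`1` bound of `Φ`**: `|Φ(t + x)| ≤ K e^{|x|} e^{-|t|}` (double-exponential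
envelope `exists_norm_phi_le`, `phiTr_envelope_le`, and `|t| − |x| ≤ |t + x|`). [folklore] -/
theorem doobP_exists_bound :
    ∃ K : ℝ, 0 ≤ K ∧ ∀ t x : ℝ,
      |2 * LagariasMontague.Psi (2 * (t + x))| ≤ K * Real.exp |x| * Real.exp (-|t|) := by
  obtain ⟨K, hK, h⟩ := exists_norm_phi_le
  refine ⟨K, hK, fun t x => ?_⟩
  have h1 := h (t + x)
  rw [norm_phi] at h1
  rw [abs_mul, abs_two]
  refine h1.trans ?_
  rw [mul_assoc, ← Real.exp_add]
  refine mul_le_mul_of_nonneg_left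
    ((phiTr_envelope_le (t + x)).trans (Real.exp_le_exp.2 ?_)) hK
  have h2 : |t| - |x| ≤ |t + x| := abs_sub_abs_le_abs_add t x
  linarith

/-- **Stub D1 — `doob_prime` (RH-free).**  For a test function `w` and `u = Φ·w`, `k = u ⋆ ũ`:
the prime term of `k` splits as `⟨g_w, x ↦ weilPrimeTerm (τ_xΦ)⟩ − Σ_n Λ(n) n^{-1/2} I_w(log n)`
(polarisation `‖Φ_h w_h − Φ w‖² = Φ Φ_h ‖w_h − w‖² + (Φ_h − Φ)(Φ_h‖w_h‖² − Φ‖w‖²)` inserted in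
`k(h) + k(−h) = 2‖u‖₂² − ∫‖u(x+h) − u(x)‖²` (`weilConv_weilReflect_add_neg`), giving
`k(h) + k(−h) = ⟨g_w, Φ(·+h) + Φ(·−h)⟩ − I_w(h)` for every `h`; both series converge absolutely by
the double-exponential decay of `Φ`; `∫`/`Σ'` swap by `integral_tsum_of_summable_integral_norm`).
[folklore] -/
theorem stub_doob_prime :
    ∀ w : ℝ → ℂ, IsWeilTest w →
      Summable (fun n : ℕ => (Λ n : ℝ) / Real.sqrt n *
        ∫ t : ℝ, 2 * LagariasMontague.Psi (2 * t) * (2 * LagariasMontague.Psi (2 * (t + Real.log n))) *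
          ‖w (t + Real.log n) - w t‖ ^ 2) ∧
      Integrable (fun x : ℝ => ((2 * LagariasMontague.Psi (2 * x) * ‖w x‖ ^ 2 : ℝ) : ℂ) *
        weilPrimeTerm (fun t : ℝ => (2 : ℂ) * LagariasMontague.Psic (2 * (t + x)))) ∧
      weilPrimeTerm (weilConv (fun t : ℝ => (2 : ℂ) * LagariasMontague.Psic (2 * t) * w t)
          (weilReflect (fun t : ℝ => (2 : ℂ) * LagariasMontague.Psic (2 * t) * w t))) =
        (∫ x : ℝ, ((2 * LagariasMontague.Psi (2 * x) * ‖w x‖ ^ 2 : ℝ) : ℂ) *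
          weilPrimeTerm (fun t : ℝ => (2 : ℂ) * LagariasMontague.Psic (2 * (t + x)))) -
        ((∑' n : ℕ, (Λ n : ℝ) / Real.sqrt n *
          ∫ t : ℝ, 2 * LagariasMontague.Psi (2 * t) * (2 * LagariasMontague.Psi (2 * (t + Real.log n))) *
            ‖w (t + Real.log n) - w t‖ ^ 2 : ℝ) : ℂ) := by
  intro w hw
  obtain ⟨K, hK0, hKb⟩ := doobP_exists_bound
  have hφc : Continuous fun t : ℝ => 2 * LagariasMontague.Psi (2 * t) :=
    continuous_const.mul ((LagariasMontague.continuous_thetaSeries _).comp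
      (continuous_const.mul continuous_id))
  have hfun : (fun t : ℝ => (2 : ℂ) * LagariasMontague.Psic (2 * t) * w t) =
      fun t : ℝ => ((2 * LagariasMontague.Psi (2 * t) : ℝ) : ℂ) * w t :=
    funext fun t => by rw [doobP_phic]
  have huT : IsWeilTest (fun t : ℝ => ((2 * LagariasMontague.Psi (2 * t) : ℝ) : ℂ) * w t) :=
    hfun ▸ ⟨contDiff_phi.mul hw.1, hw.2.mul_left⟩
  have main := doobP_main hφc hK0 hKb hw huT (fun t => rfl)
  simp only [doobP_phic]
  exact main

end Summit.RiemannHypothesis.RiemannHypothesis.Theorems.GroundStatesConvergeToXi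

end
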